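import Summits.NavierStokesRegularity.NavierStokesRegularity.Theorems.SoloRefutePermana2026Step3cls
import HarnessLib

/-!
# C119 `Permana2026` — records-grade companion: the typed Brezis–Gallouet–Wainger display (24) is kernel-false

Cell `ns-claims`, row C119 (ADJUDICATED #126: first failing step `Literature.Claims.NS.Permana2026.Step_3`
= Lemma 3.1 (7) p.3 l.33–40, class unfilled gap — UNTOUCHED here). This file refutes the DOWNSTREAM binder
`Literature.Claims.NS.Permana2026.Step_7` = display (24) p.6 l.14–20 of Zenodo 19582631 v1 as typed:
«‖ω(·,t)‖_{L∞} ≤ C_BGW ‖ω(·,t)‖_{H¹} √(log(e + ‖ω(·,t)‖_{H²}))» with ONE universal constant `C_BGW`, along every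
solution of the class (`Chae2007.IsLocalSolution`), at every time. On `ℝ³` the right-hand side does not control
the sup norm: `H¹(ℝ³) ⊄ L∞(ℝ³)`, and the logarithm of the UN-NORMALISED `H²` norm cannot repair the scaling.

KERNEL WITNESS (datum slice `t = 0`, two-parameter homothety of one fixed datum). With the tree's C137 datum
`U` (`…Theorems.LucardoOlivaes2026GI.U`, smooth, divergence free, every derivative in `L²`, with a point `x₀`
of non-zero vorticity) and `v = dil a c U`, `v(x) = a·U(c x)` (module `…Theorems.SoloRefutePermana2026Step3cls`):
`curl v (x) = (a c)·(curl U)(c x)`, so `sup|curl v| ≥ a c ‖curl U(x₀)‖ =: a c s₀`, while EXACTLY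
`‖curl v‖²_{L²} = a² c⁻¹ e`, `‖∇curl v‖²_{L²} = a² c g`, `‖∇²curl v‖²_{L²} = a² c³ h` (`e, g, h` the three
numbers of `U`). Choosing the amplitude `a = 1/(c²(e+g+h+1))` pins `‖ω‖_{H²} ≤ 1`, hence
`√log(e + ‖ω‖_{H²}) ≤ 2`; choosing the inverse length `c = (q+1)²`, `q = 2 C_BGW √(e+g)/s₀`, gives
`a c s₀ = a (q+1)² s₀ > a (q+1) q s₀ ≥ C_BGW ‖ω‖_{H¹} · 2` — contradiction at `t = 0` of the class solution
launched from `v` (`…Theorems.LucardoOlivaes2026.exists_isLocalSolution`, Majda–Bertozzi Thm 3.4).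

Main declaration: `not_Step_7 : ¬ Literature.Claims.NS.Permana2026.Step_7`. Effect on the row: with rev 6 of the
skeleton (`claim_of_live_steps : Step_3 → Step_4 → Step_7 → Step_8 → ClaimedTheorem`), every binder of the printed
chain except the token is now kernel-decided — `Step_4` TRUE (`…Permana2026Salvage.step_4_holds`), `Step_7` FALSE
(this file), `Step_8` FALSE (`…Permana2026.not_Step_8`); the token `Step_3` / class UG / #126 are untouched.
Typist ns-claims-typist-11 g7 (by-slot companion (ii) of CARD §6; refuter-7 g3 UG-AUDIT 10:08:38Z flagged the
slice). Records-grade ADDENDUM.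

WHAT THIS IS NOT: not a claim about NS regularity or blow-up; not a claim about any author beyond the
typed locator.
-/

set_option linter.dupNamespace false

noncomputable section

open Set Function Filter MeasureTheory
open scoped Topology ENNReal NNReal ContDiff RealInnerProductSpace

namespace Summit.NavierStokesRegularity.NavierStokesRegularity.Theorems.Permana2026

open Literature.Analysis.FluidPDE
open Literature.Claims.NS.Chae2007 (IsDatum IsLocalSolution)
open Literature.Claims.NS.LucardoOlivaes2026 (stretchI)
open Literature.Claims.NS.Permana2026 (Step_7 supVort h1Vort h2Vort enstrophy gradVortSq hessVortSq)
open Summit.NavierStokesRegularity.NavierStokesRegularity.Theorems.LucardoOlivaes2026GI (U isOuroDatum_U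
  isAlignedDatumI_U)
open Summit.NavierStokesRegularity.NavierStokesRegularity.Theorems.LucardoOlivaes2026 (exists_isLocalSolution)

/-! ## Scaling of the three vorticity numbers under `dil a c` -/

/-- The curl of a smooth field is smooth. [folklore] -/
theorem contDiff_curl_top {v : E3 → E3} (hv : ContDiff ℝ ∞ v) : ContDiff ℝ ∞ (curl v) := by
  rw [curl_eq_curlCLM_comp]
  exact curlCLM.contDiff.comp (hv.fderiv_right (m := ∞) (by simp))

/-- `curl (dil a c v) = dil (a c) c (curl v)` as functions. [folklore] -/
theorem curl_dil_eq (a c : ℝ) (v : E3 → E3) : curl (dil a c v) = dil (a * c) c (curl v) :=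
  funext (curl_dil a c v)

/-- Enstrophy scaling: `‖curl(dil a c v)‖²_{L²} = (a c)² c⁻³ ‖curl v‖²_{L²}` (as real numbers; junk-safe).
[folklore] -/
theorem toReal_lintegral_curl_sq_dil {v : E3 → E3} (hv : ContDiff ℝ ∞ v) (a : ℝ) {c : ℝ} (hc : 0 < c) :
    (∫⁻ x, ‖curl (dil a c v) x‖ₑ ^ 2).toReal = (a * c) ^ 2 * (c ^ 3)⁻¹ * (∫⁻ x, ‖curl v x‖ₑ ^ 2).toReal := by
  rw [curl_dil_eq, lintegral_sq_dil (contDiff_curl_top hv) _ hc, ENNReal.toReal_mul,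
    ENNReal.toReal_ofReal (by positivity)]

/-- Vorticity-gradient scaling: `∫|∇curl(dil a c v)|² = (a c²)² c⁻³ ∫|∇curl v|²` (Frobenius squares, as real
numbers). [folklore] -/
theorem toReal_lintegral_frob_fderiv_curl_dil (a : ℝ) {c : ℝ} (hc : 0 < c) (v : E3 → E3) :
    (∫⁻ x, ENNReal.ofReal (frobeniusNormSq (fderiv ℝ (curl (dil a c v)) x))).toReal =
      (a * c * c) ^ 2 * (c ^ 3)⁻¹ * (∫⁻ x, ENNReal.ofReal (frobeniusNormSq (fderiv ℝ (curl v) x))).toReal := by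
  rw [curl_dil_eq]
  have h1 : ∀ x, ENNReal.ofReal (frobeniusNormSq (fderiv ℝ (dil (a * c) c (curl v)) x)) =
      ENNReal.ofReal ((a * c * c) ^ 2) * ENNReal.ofReal (frobeniusNormSq (fderiv ℝ (curl v) (c • x))) := by
    intro x
    rw [fderiv_dil, frobeniusNormSq_smul, ENNReal.ofReal_mul (sq_nonneg _)]
  simp_rw [h1]
  rw [lintegral_const_mul' _ _ ENNReal.ofReal_ne_top,
    lintegral_comp_smul_E3 (fun x => ENNReal.ofReal (frobeniusNormSq (fderiv ℝ (curl v) x))) hc,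
    ENNReal.toReal_mul, ENNReal.toReal_mul, ENNReal.toReal_ofReal (sq_nonneg _),
    ENNReal.toReal_ofReal (by positivity)]
  ring

/-- Vorticity-Hessian scaling: `∫‖∇²curl(dil a c v)‖² = (|a c| |c|²)² c⁻³ ∫‖∇²curl v‖²` (as real numbers).
[folklore] -/
theorem toReal_lintegral_iteratedFDeriv_two_curl_dil {v : E3 → E3} (hv : ContDiff ℝ ∞ v) (a : ℝ) {c : ℝ}
    (hc : 0 < c) :
    (∫⁻ x, ‖iteratedFDeriv ℝ 2 (curl (dil a c v)) x‖ₑ ^ 2).toReal =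
      (|a * c| * |c| ^ 2) ^ 2 * (c ^ 3)⁻¹ * (∫⁻ x, ‖iteratedFDeriv ℝ 2 (curl v) x‖ₑ ^ 2).toReal := by
  rw [curl_dil_eq, lintegral_iteratedFDeriv_dil (contDiff_curl_top hv) _ hc 2, ENNReal.toReal_mul,
    ENNReal.toReal_ofReal (by positivity)]

/-! ## The datum `U`: a point of non-zero vorticity and its three vorticity numbers -/

/-- `‖curl U‖²_{L²}` of the C137 datum, as a real number. [folklore] -/
def eU : ℝ := (∫⁻ x, ‖curl U x‖ₑ ^ 2).toReal

/-- `∫|∇ curl U|²` (Frobenius) of the C137 datum, as a real number. [folklore] -/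
def gU : ℝ := (∫⁻ x, ENNReal.ofReal (frobeniusNormSq (fderiv ℝ (curl U) x))).toReal

/-- `∫‖∇² curl U‖²` of the C137 datum, as a real number. [folklore] -/
def hU : ℝ := (∫⁻ x, ‖iteratedFDeriv ℝ 2 (curl U) x‖ₑ ^ 2).toReal

/-- kit lemma (plumbing) [folklore] -/ theorem eU_nonneg : 0 ≤ eU := ENNReal.toReal_nonneg
/-- kit lemma (plumbing) [folklore] -/ theorem gU_nonneg : 0 ≤ gU := ENNReal.toReal_nonneg
/-- kit lemma (plumbing) [folklore] -/ theorem hU_nonneg : 0 ≤ hU := ENNReal.toReal_nonneg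

/-- The C137 datum has a point of non-zero vorticity (it has a point of positive vortex stretching,
`isAlignedDatumI_U`). [folklore] -/
theorem exists_curl_U_ne_zero : ∃ x₀ : E3, curl U x₀ ≠ 0 := by
  have hpos : 0 < stretchI U := isAlignedDatumI_U
  obtain ⟨x₀, hx₀⟩ : ∃ x₀ : E3, 0 < ⟪curl U x₀, fderiv ℝ U x₀ (curl U x₀)⟫ := by
    by_contra hne
    push Not at hne
    have hle : stretchI U ≤ 0 := by
      unfold stretchI
      exact integral_nonpos fun x => hne x
    exact absurd hpos (not_lt.2 hle)
  refine ⟨x₀, fun h0 => ?_⟩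
  rw [h0, inner_zero_left] at hx₀
  exact lt_irrefl _ hx₀

/-! ## The slice `t = 0` of a class solution launched from `dil a c U` -/

section Slice

variable {ν T a c : ℝ} {u : ℝ → E3 → E3} {p : ℝ → E3 → ℝ}

/-- LHS from below: in the class the vorticity sup is finite, so `‖ω(0)‖_∞ ≥ ‖curl(dil a c U)(c⁻¹x₀)‖ =
a c ‖curl U(x₀)‖`. [folklore] -/
theorem mul_norm_curl_le_supVort (hsol : IsLocalSolution ν T (dil a c U) u p) (hT : 0 < T) (ha : 0 < a)
    (hc : 0 < c) (x₀ : E3) : a * c * ‖curl U x₀‖ ≤ supVort u 0 := by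
  have hfin : (⨆ x, ‖curl (u 0) x‖ₑ) < ⊤ := by
    obtain ⟨R, hRtop, hR⟩ := exists_enorm_curl_le_of_hasBoundedSobolevNormsOn (S := Icc 0 0) (u := u)
      (fun s hs => hsol.isClassical.contDiff_velocity ⟨hs.1, lt_of_le_of_lt hs.2 hT⟩) (hsol.sobolev 0 hT)
    exact lt_of_le_of_lt (iSup_le fun x => hR 0 ⟨le_rfl, le_rfl⟩ x) hRtop
  have h1 : ‖curl (u 0) (c⁻¹ • x₀)‖ = a * c * ‖curl U x₀‖ := by
    rw [hsol.initial, curl_dil, smul_smul, mul_inv_cancel₀ hc.ne', one_smul, norm_smul, Real.norm_eq_abs,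
      abs_of_pos (by positivity)]
  unfold supVort
  rw [← h1, ← toReal_enorm]
  exact ENNReal.toReal_mono hfin.ne (le_iSup (fun x => ‖curl (u 0) x‖ₑ) (c⁻¹ • x₀))

/-- `E(0) = a² c⁻¹ e_U`. [folklore] -/
theorem enstrophy_slice (hsol : IsLocalSolution ν T (dil a c U) u p) (hc : 0 < c) :
    enstrophy u 0 = a ^ 2 / c * eU := by
  unfold enstrophy eU
  rw [hsol.initial, toReal_lintegral_curl_sq_dil isOuroDatum_U.1.1 a hc]
  field_simp

/-- `‖∇ω(0)‖² = a² c g_U`. [folklore] -/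
theorem gradVortSq_slice (hsol : IsLocalSolution ν T (dil a c U) u p) (hc : 0 < c) :
    gradVortSq u 0 = a ^ 2 * c * gU := by
  unfold gradVortSq gU
  rw [hsol.initial, toReal_lintegral_frob_fderiv_curl_dil a hc U]
  field_simp

/-- `‖∇²ω(0)‖² = a² c³ h_U`. [folklore] -/
theorem hessVortSq_slice (hsol : IsLocalSolution ν T (dil a c U) u p) (hc : 0 < c) :
    hessVortSq u 0 = a ^ 2 * c ^ 3 * hU := by
  unfold hessVortSq hU
  rw [hsol.initial, toReal_lintegral_iteratedFDeriv_two_curl_dil isOuroDatum_U.1.1 a hc,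
    mul_pow, sq_abs, ← pow_mul, show 2 * 2 = 4 by norm_num, pow_abs, abs_of_pos (pow_pos hc 4)]
  field_simp

/-- `‖ω(0)‖_{H¹} ≤ a √c √(e_U + g_U)` for `c ≥ 1`, `a > 0`. [folklore] -/
theorem h1Vort_slice_le (hsol : IsLocalSolution ν T (dil a c U) u p) (ha : 0 < a) (hc : 1 ≤ c) :
    h1Vort u 0 ≤ a * Real.sqrt c * Real.sqrt (eU + gU) := by
  have hc0 : 0 < c := by linarith
  unfold h1Vort
  rw [enstrophy_slice hsol hc0, gradVortSq_slice hsol hc0]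
  have hac : a ^ 2 / c ≤ a ^ 2 * c :=
    (div_le_self (sq_nonneg a) hc).trans (le_mul_of_one_le_right (sq_nonneg a) hc)
  have hH1 : a ^ 2 / c * eU + a ^ 2 * c * gU ≤ a ^ 2 * c * (eU + gU) := by
    have := mul_le_mul_of_nonneg_right hac eU_nonneg
    linarith
  calc Real.sqrt (a ^ 2 / c * eU + a ^ 2 * c * gU) ≤ Real.sqrt (a ^ 2 * c * (eU + gU)) :=
        Real.sqrt_le_sqrt hH1
    _ = a * Real.sqrt c * Real.sqrt (eU + gU) := by
        rw [Real.sqrt_mul (by positivity), Real.sqrt_mul (sq_nonneg a), Real.sqrt_sq ha.le]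

/-- `‖ω(0)‖_{H²} ≤ 1` once `a² c³ (e_U + g_U + h_U) ≤ 1` and `c ≥ 1`. [folklore] -/
theorem h2Vort_slice_le_one (hsol : IsLocalSolution ν T (dil a c U) u p) (hc : 1 ≤ c)
    (hsmall : a ^ 2 * c ^ 3 * (eU + gU + hU) ≤ 1) : h2Vort u 0 ≤ 1 := by
  have hc0 : 0 < c := by linarith
  unfold h2Vort
  rw [enstrophy_slice hsol hc0, gradVortSq_slice hsol hc0, hessVortSq_slice hsol hc0]
  have hcc : c ≤ c ^ 3 := le_self_pow₀ hc (by norm_num)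
  have h1c : a ^ 2 / c ≤ a ^ 2 * c ^ 3 :=
    (div_le_self (sq_nonneg a) hc).trans (le_mul_of_one_le_right (sq_nonneg a) (one_le_pow₀ hc))
  have h2c : a ^ 2 * c ≤ a ^ 2 * c ^ 3 := mul_le_mul_of_nonneg_left hcc (sq_nonneg a)
  have hsum : a ^ 2 / c * eU + a ^ 2 * c * gU + a ^ 2 * c ^ 3 * hU ≤ a ^ 2 * c ^ 3 * (eU + gU + hU) := by
    have e1 := mul_le_mul_of_nonneg_right h1c eU_nonneg
    have e2 := mul_le_mul_of_nonneg_right h2c gU_nonneg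
    linarith
  rw [show (1:ℝ) = Real.sqrt 1 from Real.sqrt_one.symm]
  exact Real.sqrt_le_sqrt (hsum.trans hsmall)

end Slice

/-- `√log(e + y) ≤ 2` for `0 ≤ y ≤ 1` (crude: `log x ≤ x − 1`, `e < 3`). [folklore] -/
theorem sqrt_log_exp_one_add_le_two {y : ℝ} (hy0 : 0 ≤ y) (hy1 : y ≤ 1) :
    Real.sqrt (Real.log (Real.exp 1 + y)) ≤ 2 := by
  have hx : 0 < Real.exp 1 + y := by positivity
  have h1 := Real.log_le_sub_one_of_pos hx
  have h2 : Real.exp 1 < 3 := lt_trans Real.exp_one_lt_d9 (by norm_num)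
  have h3 : Real.log (Real.exp 1 + y) ≤ 4 := by linarith
  calc Real.sqrt _ ≤ Real.sqrt 4 := Real.sqrt_le_sqrt h3
    _ = 2 := by rw [show (4:ℝ) = 2 ^ 2 by norm_num, Real.sqrt_sq (by norm_num)]

/-! ## The kill -/

/-- **`Step_7` is false**: the typed display (24) p.6 l.14–20 («‖ω‖_{L∞} ≤ C_BGW‖ω‖_{H¹}√log(e+‖ω‖_{H²})»,
one universal constant, every class solution, every time) fails at `t = 0` along the class solutions launched
from the homothetic data `dil a c U` — concentration (`c → ∞`) beats `H¹` in three dimensions and the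
amplitude `a` keeps the `H²` norm below `1`, freezing the logarithm. Records-grade companion to #126; the token
`Step_3` is untouched. [cite: Permana2026, (24) p.6 l.14–20] -/
theorem not_Step_7 : ¬ Step_7 := by
  rintro ⟨C, hC, h⟩
  obtain ⟨x₀, hx₀⟩ := exists_curl_U_ne_zero
  have hs₀ : 0 < ‖curl U x₀‖ := norm_pos_iff.2 hx₀
  -- the scales
  obtain ⟨q, hqdef⟩ : ∃ q : ℝ, q = 2 * C * Real.sqrt (eU + gU) / ‖curl U x₀‖ := ⟨_, rfl⟩
  have hq : 0 ≤ q := by rw [hqdef]; positivity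
  have hqs : q * ‖curl U x₀‖ = 2 * C * Real.sqrt (eU + gU) := by rw [hqdef]; field_simp
  obtain ⟨c, hcdef⟩ : ∃ c : ℝ, c = (q + 1) ^ 2 := ⟨_, rfl⟩
  have hc0 : 0 < c := by rw [hcdef]; positivity
  have hc1 : 1 ≤ c := by rw [hcdef]; nlinarith
  have hsqc : Real.sqrt c = q + 1 := by rw [hcdef, Real.sqrt_sq (by linarith)]
  obtain ⟨m, hmdef⟩ : ∃ m : ℝ, m = eU + gU + hU + 1 := ⟨_, rfl⟩
  have hm1 : 1 ≤ m := by rw [hmdef]; linarith [eU_nonneg, gU_nonneg, hU_nonneg]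
  have hm0 : 0 < m := by linarith
  obtain ⟨a, hadef⟩ : ∃ a : ℝ, a = 1 / (c ^ 2 * m) := ⟨_, rfl⟩
  have ha0 : 0 < a := by rw [hadef]; positivity
  have hsmall : a ^ 2 * c ^ 3 * (eU + gU + hU) ≤ 1 := by
    have h1 : a ^ 2 * c ^ 3 = 1 / (c * m ^ 2) := by
      rw [hadef]; field_simp
    have h2 : eU + gU + hU = m - 1 := by rw [hmdef]; ring
    rw [h1, h2, one_div, inv_mul_le_iff₀ (by positivity), mul_one]
    have h3 : m ≤ m ^ 2 := by nlinarith
    have h4 : m ^ 2 ≤ c * m ^ 2 := le_mul_of_one_le_left (sq_nonneg _) hc1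
    linarith
  -- the dilated datum and a class solution from it (`ν = 1`)
  have hvdat : IsDatum (dil a c U) := isDatum_dil isOuroDatum_U.1 a hc0
  obtain ⟨T, hT, u, p, hsol⟩ := exists_isLocalSolution zero_le_one hvdat
  -- the display at `t = 0`, and the slice bounds
  have key := h 1 one_pos T hT _ u p hsol 0 ⟨le_rfl, hT⟩
  have hL := mul_norm_curl_le_supVort hsol hT ha0 hc0 x₀
  have hH1 := h1Vort_slice_le hsol ha0 hc1
  have hH2 := h2Vort_slice_le_one hsol hc1 hsmall
  have h2nn : 0 ≤ h2Vort u 0 := Real.sqrt_nonneg _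
  have hlog : Real.sqrt (Real.log (Real.exp 1 + h2Vort u 0)) ≤ 2 := sqrt_log_exp_one_add_le_two h2nn hH2
  have h1nn : 0 ≤ h1Vort u 0 := Real.sqrt_nonneg _
  have hR : C * h1Vort u 0 * Real.sqrt (Real.log (Real.exp 1 + h2Vort u 0)) ≤
      C * (a * Real.sqrt c * Real.sqrt (eU + gU)) * 2 := by
    gcongr
  have hfinal : a * c * ‖curl U x₀‖ ≤ C * (a * Real.sqrt c * Real.sqrt (eU + gU)) * 2 :=
    hL.trans (key.trans hR)
  -- arithmetic: `a (q+1)² s₀ ≤ a (q+1) q s₀` is absurd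
  rw [hsqc] at hfinal
  have hfinal' : a * (q + 1) ^ 2 * ‖curl U x₀‖ ≤ a * (q + 1) * (q * ‖curl U x₀‖) := by
    have e1 : C * (a * (q + 1) * Real.sqrt (eU + gU)) * 2 = a * (q + 1) * (2 * C * Real.sqrt (eU + gU)) := by
      ring
    rw [e1, ← hqs, hcdef] at hfinal
    exact hfinal
  have hpos' : 0 < a * (q + 1) * ‖curl U x₀‖ := by positivity
  nlinarith

/-- FQN guard: the refuted face is the Literature decl of record. [cite: Permana2026, (24) p.6 l.14–20] -/
example : ¬ Literature.Claims.NS.Permana2026.Step_7 := not_Step_7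

end Summit.NavierStokesRegularity.NavierStokesRegularity.Theorems.Permana2026

end
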